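import Literature.AlgebraicGeometry.Resolution.DiffStableAdjoin
import Mathlib.Algebra.MvPolynomial.PDeriv
import Mathlib.FieldTheory.RatFunc.Degree
import Mathlib.Algebra.Field.ZMod
import HarnessLib

/-!
# Graded, differentially stable subalgebras, III: the hypotheses "all Hasse–Schmidt orders" and "perfect ground field" are sharp

Topic: `Literature/AlgebraicGeometry/Resolution`. Two kernel-checked counterexamples delimiting the
structure theorem `U = K[ℓ_1^{p^{e_1}}, …, ℓ_r^{p^{e_r}}]` for graded subalgebras `U ⊆ K[x]` stable
under all Hasse–Schmidt derivations over a PERFECT field (`DiffStableSubalgebra.lean`,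
`DiffStableAdjoin.lean`) — the characteristic-`p` precision points recorded by the referee cell
`pub-hironaka` for the edge algebras of Hironaka's 2017 manuscript (STEPS.md §A⁗ A⁗.3/A⁗.9; the
manuscript has both hypotheses: "Diff" = all orders, (22) p.18, and `K` perfect, p.20 l.10–12).

1. **All orders are needed** (`U₁ = K[(xy)^p] ⊆ K[x, y]`, `p ≠ 0`):
   `isGradedSubalgebra_adjoin_xyPow`, **`pderiv_mem_adjoin_xyPow`** (in characteristic `p`, `U₁` is
   stable under the first-order partial derivatives `∂/∂x, ∂/∂y` — indeed they kill the
   generator), but **`hasseDeriv_xyPow : D^{(p e_x)} (xy)^p = y^p`**, `X_pow_notMem_adjoin_xyPow`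
   (`y^p ∉ U₁`: every monomial of an element of `U₁` has equal `x`- and `y`-exponents), hence
   **`not_isDiffStable_adjoin_xyPow`** and **`not_exists_presentation_adjoin_xyPow`**: `U₁` is not of
   the form `K[ℓ_j^{p^{e_j}}]` for ANY linear forms (`p` the exponential characteristic).
2. **Perfectness is needed** (`char K = p`, `t ∈ K` not a `p`-th power,
   `U₂ = K[x^p + t y^p] ⊆ K[x, y]`): `isGradedSubalgebra_adjoin_frobTwist`,
   **`isDiffStable_adjoin_frobTwist`** (`U₂` IS graded and stable under ALL Hasse–Schmidt
   derivations), but **`not_exists_presentation_adjoin_frobTwist`**: there are no `K`-linearly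
   independent linear forms `ℓ_j` and exponents with `U₂ = K[ℓ_j^{p^{e_j}}]` (the degree-`p` piece of
   `U₂` is the line `K·(x^p + t y^p)`, and `x^p + t y^p = c·ℓ^p` forces `t = (v_1/v_0)^p`);
   **`ratFunc_counterexample`** — the instance `K = 𝔽_p(X)`, `t = X`.
   (The correct general statement over imperfect fields is Hironaka's triangular form with
   coefficients, Giraud 1975 Lemme 1.6 (3) / 1.7 — not formalised.)

Auxiliary: `Derivation.apply_mem_adjoin_of_forall_mem` (a derivation preserving the generators
preserves `R[S]`), `homogeneousComponent_eq_zero_of_mem_adjoin_singleton` /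
`exists_homogeneousComponent_eq_smul_of_mem_adjoin_singleton` (graded pieces of `K[g]`, `g` a form).

## References

* H. Hironaka, *Additive groups associated with points of a projective space*, Ann. of Math. 92
  (1970) 327–334. [Hironaka1970AdditiveGroups]
* J. Giraud, *Contact maximal en caractéristique positive*, Ann. Sci. ÉNS (4) 8 (1975) 201–234,
  §1.6. [Giraud1975]
-/

open MvPolynomial

namespace Literature.AlgebraicGeometry.Resolution

/-! ## Auxiliary: derivations and generated subalgebras; graded pieces of `K[g]` -/

section Aux

variable {R : Type*} [CommRing R] {A : Type*} [CommRing A] [Algebra R A]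

/-- A derivation that maps every generator into `R[S]` maps `R[S]` into itself (Leibniz).
[folklore] -/
theorem _root_.Derivation.apply_mem_adjoin_of_forall_mem (D : Derivation R A A) {S : Set A}
    (hS : ∀ s ∈ S, D s ∈ Algebra.adjoin R S) {f : A} (hf : f ∈ Algebra.adjoin R S) :
    D f ∈ Algebra.adjoin R S := by
  induction hf using Algebra.adjoin_induction with
  | mem x hx => exact hS x hx
  | algebraMap r => rw [Derivation.map_algebraMap]; exact zero_mem _
  | add x y _ _ ihx ihy => rw [map_add]; exact add_mem ihx ihy
  | mul x y hx hy ihx ihy =>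
    rw [Derivation.leibniz, smul_eq_mul, smul_eq_mul]
    exact add_mem (mul_mem hx ihy) (mul_mem hy ihx)

variable {σ : Type*} {K : Type*} [Field K]

/-- In `K[g]`, `g` a form of degree `N > 0`, there is nothing in degrees not divisible by `N`.
[folklore] -/
theorem homogeneousComponent_eq_zero_of_mem_adjoin_singleton {g : MvPolynomial σ K} {N : ℕ}
    (hg : g.IsHomogeneous N) {f : MvPolynomial σ K} (hf : f ∈ Algebra.adjoin K {g}) {d : ℕ}
    (hd : ¬ N ∣ d) : homogeneousComponent d f = 0 := by
  rw [Algebra.adjoin_singleton_eq_range_aeval] at hf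
  obtain ⟨P, rfl⟩ := (AlgHom.mem_range _).mp hf
  rw [Polynomial.aeval_eq_sum_range, map_sum]
  refine Finset.sum_eq_zero fun k _ => ?_
  rw [map_smul, homogeneousComponent_of_mem (hg.pow k), if_neg, smul_zero]
  rintro rfl
  exact hd (Dvd.intro k rfl)

/-- In `K[g]`, `g` a form of degree `N > 0`, the degree-`N` piece is the line `K·g`. [folklore] -/
theorem exists_homogeneousComponent_eq_smul_of_mem_adjoin_singleton {g : MvPolynomial σ K}
    {N : ℕ} (hg : g.IsHomogeneous N) (hN : 0 < N) {f : MvPolynomial σ K}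
    (hf : f ∈ Algebra.adjoin K {g}) : ∃ c : K, homogeneousComponent N f = c • g := by
  rw [Algebra.adjoin_singleton_eq_range_aeval] at hf
  obtain ⟨P, rfl⟩ := (AlgHom.mem_range _).mp hf
  refine ⟨P.coeff 1, ?_⟩
  rw [Polynomial.aeval_eq_sum_range, map_sum]
  rw [Finset.sum_eq_single 1]
  · rw [map_smul, homogeneousComponent_of_mem (hg.pow 1), if_pos (by rw [mul_one]), pow_one]
  · intro k _ hk
    rw [map_smul, homogeneousComponent_of_mem (hg.pow k), if_neg, smul_zero]
    intro h
    apply hk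
    have : N * k = N * 1 := by rw [mul_one]; exact h.symm
    exact Nat.eq_of_mul_eq_mul_left hN this
  · intro h1
    rw [Finset.mem_range, not_lt] at h1
    rw [Polynomial.coeff_eq_zero_of_natDegree_lt (by omega), zero_smul, map_zero]

end Aux

/-! ## 1. All Hasse–Schmidt orders are needed: `U₁ = K[(xy)^p]` -/

section AllOrders

variable (K : Type*) [Field K] (p : ℕ)

/-- `(xy)^p ∈ K[x, y]` (`x = X 0`, `y = X 1`). [folklore] -/
noncomputable def xyPow : MvPolynomial (Fin 2) K := (X 0 * X 1) ^ p

/-- `(xy)^p` is a form of degree `2p`. [folklore] -/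
theorem isHomogeneous_xyPow : (xyPow K p).IsHomogeneous (2 * p) := by
  have h := ((isHomogeneous_X K (0 : Fin 2)).mul (isHomogeneous_X K 1)).pow p
  have e : (1 + 1) * p = 2 * p := by ring
  rw [← e]
  exact h

/-- `U₁ = K[(xy)^p]` is a graded subalgebra. [folklore] -/
theorem isGradedSubalgebra_adjoin_xyPow : IsGradedSubalgebra (Algebra.adjoin K {xyPow K p}) :=
  IsGradedSubalgebra.adjoin fun s hs =>
    ⟨2 * p, by rw [Set.mem_singleton_iff.mp hs]; exact isHomogeneous_xyPow K p⟩

/-- In characteristic `p` the first-order partial derivatives kill `(xy)^p`. [folklore] -/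
theorem pderiv_xyPow [CharP K p] (i : Fin 2) : pderiv i (xyPow K p) = 0 := by
  rw [xyPow, Derivation.leibniz_pow, smul_eq_mul, nsmul_eq_mul, CharP.cast_eq_zero, zero_mul]

/-- **`U₁ = K[(xy)^p]` is stable under the first-order partial derivatives `∂/∂x`, `∂/∂y`**
(`char K = p`) — "differentially closed" in the naive first-order sense. [folklore] -/
theorem pderiv_mem_adjoin_xyPow [CharP K p] (i : Fin 2) {f : MvPolynomial (Fin 2) K}
    (hf : f ∈ Algebra.adjoin K {xyPow K p}) : pderiv i f ∈ Algebra.adjoin K {xyPow K p} :=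
  (pderiv i : Derivation K (MvPolynomial (Fin 2) K) (MvPolynomial (Fin 2) K))
    |>.apply_mem_adjoin_of_forall_mem
      (fun s hs => by rw [Set.mem_singleton_iff.mp hs, pderiv_xyPow]; exact zero_mem _) hf

/-- **But the Hasse–Schmidt derivative of order `p` in `x` does not: `D^{(p e_x)} (xy)^p = y^p`**
(over any commutative ring). [folklore] -/
theorem hasseDeriv_xyPow :
    hasseDeriv K (Finsupp.single 0 p) (xyPow K p) = (X 1 ^ p : MvPolynomial (Fin 2) K) := by
  rw [xyPow, mul_pow, hasseDeriv_mul, Finset.sum_eq_single (Finsupp.single 0 p, 0)]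
  · dsimp only
    rw [hasseDeriv_X_pow, Nat.choose_self, Nat.sub_self, pow_zero, mul_one, Nat.cast_one, one_mul,
      hasseDeriv_zero, LinearMap.id_apply]
  · rintro ⟨γ, δ⟩ hc hne
    rw [Finset.mem_antidiagonal] at hc
    dsimp only at hc ⊢
    -- `δ ≠ 0` is supported at `x` (as `γ + δ = p e_x`), so `D^{(δ)} y^p = 0`
    have hδ : δ ≠ 0 := by
      rintro rfl
      apply hne
      rw [add_zero] at hc
      rw [hc]
    have hδ1 : δ 1 = 0 := by
      have h := DFunLike.congr_fun hc 1
      rw [Finsupp.add_apply, Finsupp.single_apply, if_neg (by decide)] at h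
      omega
    have hδ' : δ ≠ Finsupp.single 1 (δ 1) := by
      rw [hδ1, Finsupp.single_zero]
      exact hδ
    rw [hasseDeriv_X_pow_of_ne 1 p hδ', mul_zero]
  · intro h
    exact absurd (Finset.mem_antidiagonal.mpr (add_zero _)) h

/-- Every monomial of an element of `K[(xy)^p]` has equal `x`- and `y`-exponents. [folklore] -/
theorem apply_zero_eq_apply_one_of_mem_adjoin_xyPow {f : MvPolynomial (Fin 2) K}
    (hf : f ∈ Algebra.adjoin K {xyPow K p}) : ∀ m ∈ f.support, m 0 = m 1 := by
  induction hf using Algebra.adjoin_induction with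
  | mem x hx =>
    rw [Set.mem_singleton_iff.mp hx, xyPow]
    intro m hm
    rw [mul_pow, X_pow_eq_monomial, X_pow_eq_monomial, monomial_mul, one_mul] at hm
    obtain rfl := Finset.mem_singleton.mp (support_monomial_subset hm)
    simp
  | algebraMap r =>
    intro m hm
    rw [MvPolynomial.algebraMap_eq, mem_support_iff, coeff_C] at hm
    split_ifs at hm with h
    · subst h; rfl
    · exact absurd rfl hm
  | add x y _ _ ihx ihy =>
    intro m hm
    rcases Finset.mem_union.mp (support_add hm) with h | h
    · exact ihx m h
    · exact ihy m h
  | mul x y _ _ ihx ihy =>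
    intro m hm
    obtain ⟨a, ha, b, hb, rfl⟩ := Finset.mem_add.mp (support_mul x y hm)
    simp only [Finsupp.coe_add, Pi.add_apply]
    rw [ihx a ha, ihy b hb]

/-- `y^p ∉ K[(xy)^p]` (`p ≠ 0`). [folklore] -/
theorem X_pow_notMem_adjoin_xyPow (hp : p ≠ 0) :
    (X 1 ^ p : MvPolynomial (Fin 2) K) ∉ Algebra.adjoin K {xyPow K p} := by
  intro h
  have := apply_zero_eq_apply_one_of_mem_adjoin_xyPow K p h (Finsupp.single 1 p)
    (by rw [support_X_pow, Finset.mem_singleton])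
  rw [Finsupp.single_apply, Finsupp.single_apply, if_neg (by decide), if_pos rfl] at this
  exact hp this.symm

/-- **`U₁ = K[(xy)^p]` (`p ≠ 0`) is NOT stable under all Hasse–Schmidt derivations** — although
it is graded and, in characteristic `p`, closed under the first-order partial derivatives.
[folklore] -/
theorem not_isDiffStable_adjoin_xyPow (hp : p ≠ 0) :
    ¬ IsDiffStable (Algebra.adjoin K {xyPow K p}) := by
  intro h
  apply X_pow_notMem_adjoin_xyPow K p hp
  rw [← hasseDeriv_xyPow K p]
  exact h _ (Algebra.subset_adjoin rfl) _

/-- **Consequently `U₁` is not of the form `K[ℓ_1^{p^{e_1}}, …, ℓ_r^{p^{e_r}}]` for ANY linear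
forms `ℓ_j`** (`p` the exponential characteristic; those algebras are Hasse–Schmidt stable,
`isDiffStable_adjoin_pow_of_mem_span`): the structure theorem fails for graded subalgebras that
are only first-order differentially closed. [folklore] -/
theorem not_exists_presentation_adjoin_xyPow [ExpChar K p] (hp : p ≠ 0) :
    ¬ ∃ (r : ℕ) (ℓ : Fin r → MvPolynomial (Fin 2) K) (e : Fin r → ℕ),
      (∀ j, ℓ j ∈ Submodule.span K (Set.range (X : Fin 2 → MvPolynomial (Fin 2) K))) ∧
      Algebra.adjoin K {xyPow K p} = Algebra.adjoin K (Set.range fun j => ℓ j ^ p ^ e j) := by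
  rintro ⟨r, ℓ, e, hℓ, hU⟩
  apply not_isDiffStable_adjoin_xyPow K p hp
  rw [hU]
  exact isDiffStable_adjoin_pow_of_mem_span p ℓ hℓ e

end AllOrders

/-! ## 2. Perfectness is needed: `U₂ = K[x^p + t y^p]`, `t ∉ K^p` -/

section Perfectness

variable (K : Type*) [Field K] (p : ℕ) (t : K)

/-- `x^p + t y^p ∈ K[x, y]`. [folklore] -/
noncomputable def frobTwist : MvPolynomial (Fin 2) K := X 0 ^ p + C t * X 1 ^ p

/-- `x^p + t y^p` is a form of degree `p`. [folklore] -/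
theorem isHomogeneous_frobTwist : (frobTwist K p t).IsHomogeneous p :=
  (isHomogeneous_X_pow 0 p).add ((isHomogeneous_X_pow 1 p).C_mul t)

/-- `U₂ = K[x^p + t y^p]` is graded. [folklore] -/
theorem isGradedSubalgebra_adjoin_frobTwist :
    IsGradedSubalgebra (Algebra.adjoin K {frobTwist K p t}) :=
  IsGradedSubalgebra.adjoin fun s hs =>
    ⟨p, by rw [Set.mem_singleton_iff.mp hs]; exact isHomogeneous_frobTwist K p t⟩

/-- **`U₂ = K[x^p + t y^p]` is stable under ALL Hasse–Schmidt derivations** (`p` the exponential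
characteristic: every derivative of positive order of the generator is a constant). [folklore] -/
theorem isDiffStable_adjoin_frobTwist [ExpChar K p] :
    IsDiffStable (Algebra.adjoin K {frobTwist K p t}) := by
  refine IsDiffStable.adjoin fun s hs β => ?_
  rw [Set.mem_singleton_iff.mp hs]
  by_cases hβ : β = 0
  · subst hβ
    rw [hasseDeriv_zero, LinearMap.id_apply]
    exact Algebra.subset_adjoin rfl
  · obtain ⟨c₀, hc₀⟩ := exists_hasseDeriv_X_pow_expChar_pow_eq_C (K := K) p (0 : Fin 2) 1 hβ
    obtain ⟨c₁, hc₁⟩ := exists_hasseDeriv_X_pow_expChar_pow_eq_C (K := K) p (1 : Fin 2) 1 hβ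
    rw [pow_one] at hc₀ hc₁
    have h : hasseDeriv K β (frobTwist K p t) = C (c₀ + t * c₁) := by
      rw [frobTwist, map_add, C_mul', map_smul, hc₀, hc₁, smul_eq_C_mul, ← C_mul, ← C_add]
    rw [h, ← MvPolynomial.algebraMap_eq]
    exact Subalgebra.algebraMap_mem _ _

/-- The coefficients of `x^p + t y^p` at `x^p` and at `y^p` (`p ≠ 0`). [folklore] -/
theorem coeff_frobTwist (hp : p ≠ 0) :
    coeff (Finsupp.single 0 p) (frobTwist K p t) = 1 ∧
      coeff (Finsupp.single 1 p) (frobTwist K p t) = t := by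
  have h01 : Finsupp.single (1 : Fin 2) p ≠ Finsupp.single 0 p := by
    rw [Ne, Finsupp.single_eq_single_iff]; simp [hp]
  have h10 : Finsupp.single (0 : Fin 2) p ≠ Finsupp.single 1 p := fun h => h01 h.symm
  simp [frobTwist, coeff_X_pow, h01, h10]

/-- `x^p + t y^p ≠ 0`. [folklore] -/
theorem frobTwist_ne_zero (hp : p ≠ 0) : frobTwist K p t ≠ 0 := by
  intro h
  have := (coeff_frobTwist K p t hp).1
  rw [h, coeff_zero] at this
  exact zero_ne_one this

/-- The coefficients of `ℓ^p = Σ v_i^p x_i^p` at `x^p` and at `y^p` (`p ≠ 0` the exponential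
characteristic). [folklore] -/
theorem coeff_linearForm_pow [ExpChar K p] (hp : p ≠ 0) (v : Fin 2 → K) :
    coeff (Finsupp.single 0 p) (linearForm K v ^ p) = v 0 ^ p ∧
      coeff (Finsupp.single 1 p) (linearForm K v ^ p) = v 1 ^ p := by
  have h01 : Finsupp.single (1 : Fin 2) p ≠ Finsupp.single 0 p := by
    rw [Ne, Finsupp.single_eq_single_iff]; simp [hp]
  have h10 : Finsupp.single (0 : Fin 2) p ≠ Finsupp.single 1 p := fun h => h01 h.symm
  have h := linearForm_pow_expChar_pow p v 1
  rw [pow_one] at h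
  rw [h, Fin.sum_univ_two, coeff_add, coeff_add]
  simp only [coeff_C_mul, coeff_X_pow, h01, h10, if_true, if_false, mul_one, mul_zero, add_zero,
    zero_add, and_self]

/-- **Over a field of characteristic `p` in which `t` is not a `p`-th power,
`U₂ = K[x^p + t y^p]` — although graded and stable under all Hasse–Schmidt derivations — is NOT
of the form `K[ℓ_1^{p^{e_1}}, …, ℓ_r^{p^{e_r}}]` with `K`-linearly independent linear forms
`ℓ_j`.** So perfectness cannot be dropped from the structure theorem
(`exists_eq_adjoin_pow_linearForms_of_isDiffStable`); over imperfect fields only Hironaka's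
triangular form with coefficients survives (Giraud 1975, 1.6 (3), 1.7). Proof: the degree-`p`
piece of `U₂` is the line `K·(x^p + t y^p)`; a generator `ℓ_j^{p^{e_j}}` with `e_j = 0` is
impossible (no linear forms in `U₂`) and one with `e_j = 1` must exist (else all degrees in `U₂`
are multiples of `p²`), whence `ℓ^p = c (x^p + t y^p)` and `t = (v_1/v_0)^p`. [folklore] -/
theorem not_exists_presentation_adjoin_frobTwist [hp : Fact p.Prime] [CharP K p]
    (ht : ∀ s : K, s ^ p ≠ t) :
    ¬ ∃ (r : ℕ) (ℓ : Fin r → MvPolynomial (Fin 2) K) (e : Fin r → ℕ),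
      (∀ j, ℓ j ∈ Submodule.span K (Set.range (X : Fin 2 → MvPolynomial (Fin 2) K))) ∧
      LinearIndependent K ℓ ∧
      Algebra.adjoin K {frobTwist K p t} = Algebra.adjoin K (Set.range fun j => ℓ j ^ p ^ e j) := by
  rintro ⟨r, ℓ, e, hℓ, hli, hU⟩
  have hp0 : p ≠ 0 := hp.out.ne_zero
  have hp1 : 1 < p := hp.out.one_lt
  have hg := isHomogeneous_frobTwist K p t
  have hℓ1 : ∀ j, (ℓ j).IsHomogeneous 1 := fun j => isHomogeneous_one_of_mem_span (hℓ j)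
  -- the generators lie in `U₂`
  have hmem : ∀ j, ℓ j ^ p ^ e j ∈ Algebra.adjoin K {frobTwist K p t} := fun j => by
    rw [hU]; exact Algebra.subset_adjoin ⟨j, rfl⟩
  -- Step A: every exponent is positive (there are no linear forms in `K[g]`)
  have he : ∀ j, e j ≠ 0 := by
    intro j hj
    have h1 : ℓ j ∈ Algebra.adjoin K {frobTwist K p t} := by simpa [hj] using hmem j
    have hz := homogeneousComponent_eq_zero_of_mem_adjoin_singleton hg h1 (d := 1)
      (by rw [Nat.dvd_one]; exact hp.out.ne_one)
    rw [homogeneousComponent_of_mem (hℓ1 j), if_pos rfl] at hz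
    exact hli.ne_zero j hz
  -- Step B: some exponent equals `1` (else `g`, of degree `p`, is the image of the weighted piece
  -- of weight `p` of a polynomial in the `ℓ_j^{p^{e_j}}`, all of weight divisible by `p²`)
  have hB : ∃ j₀, e j₀ = 1 := by
    by_contra hne
    have he2 : ∀ j, 2 ≤ e j := fun j => by
      have := he j
      by_contra h'
      exact hne ⟨j, by omega⟩
    have hgU : frobTwist K p t ∈ Algebra.adjoin K (Set.range fun j => ℓ j ^ p ^ e j) := by
      rw [← hU]; exact Algebra.subset_adjoin rfl
    rw [Algebra.adjoin_range_eq_range_aeval] at hgU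
    obtain ⟨F, hF⟩ := (AlgHom.mem_range _).mp hgU
    have hcomp := homogeneousComponent_aeval_pow ℓ hℓ1 (fun j => p ^ e j) p F
    beta_reduce at hcomp
    rw [hF, homogeneousComponent_of_mem hg, if_pos rfl] at hcomp
    have hw : weightedHomogeneousComponent (fun j => p ^ e j) p F = 0 := by
      apply weightedHomogeneousComponent_eq_zero'
      intro d _ hd
      rw [weight_eq_sum] at hd
      have hdvd : p ^ 2 ∣ ∑ j, d j * p ^ e j :=
        Finset.dvd_sum fun j _ => Dvd.dvd.mul_left (pow_dvd_pow p (he2 j)) (d j)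
      rw [hd, pow_two] at hdvd
      have := Nat.le_of_dvd hp.out.pos hdvd
      nlinarith
    rw [hw, map_zero] at hcomp
    exact frobTwist_ne_zero K p t hp0 hcomp
  obtain ⟨j₀, hj₀⟩ := hB
  -- Step C: `ℓ_{j₀}^p = c · g`
  have hmem₀ : ℓ j₀ ^ p ∈ Algebra.adjoin K {frobTwist K p t} := by simpa [hj₀] using hmem j₀
  obtain ⟨c, hc⟩ :=
    exists_homogeneousComponent_eq_smul_of_mem_adjoin_singleton hg hp.out.pos hmem₀
  have hℓp : (ℓ j₀ ^ p).IsHomogeneous p := by simpa using (hℓ1 j₀).pow p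
  rw [homogeneousComponent_of_mem hℓp, if_pos rfl] at hc
  -- Step D: compare the coefficients at `x^p` and `y^p`
  obtain ⟨v, hv⟩ := exists_linearForm_eq_of_mem_span (hℓ j₀)
  rw [← hv] at hc
  obtain ⟨h0, h1⟩ := coeff_linearForm_pow K p hp0 v
  obtain ⟨g0, g1⟩ := coeff_frobTwist K p t hp0
  rw [hc, smul_eq_C_mul, coeff_C_mul, g0, mul_one] at h0
  rw [hc, smul_eq_C_mul, coeff_C_mul, g1] at h1
  -- `h0 : c = v 0 ^ p`, `h1 : c * t = v 1 ^ p`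
  by_cases hc0 : c = 0
  · have hv0 : v 0 = 0 := pow_eq_zero_iff hp0 |>.mp (h0 ▸ hc0)
    have hv1 : v 1 = 0 := pow_eq_zero_iff hp0 |>.mp (by rw [← h1, hc0, zero_mul])
    apply hli.ne_zero j₀
    rw [← hv]
    exact linearForm_eq_zero K v fun j => by fin_cases j <;> assumption
  · refine ht (v 1 / v 0) ?_
    have hv0 : v 0 ^ p ≠ 0 := fun h => hc0 (h0.trans h)
    rw [div_pow, ← h1, ← h0, mul_div_cancel_left₀ t hc0]

end Perfectness

/-! ### The instance `K = 𝔽_p(X)`, `t = X` -/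

section RatFuncInstance

/-- `deg (x^n) = n · deg x` for the `ℤ`-valued degree on `K(X)`. [folklore] -/
theorem intDegree_pow_of_ne_zero {F : Type*} [Field F] (x : RatFunc F) (hx : x ≠ 0) (n : ℕ) :
    (x ^ n).intDegree = n * x.intDegree := by
  induction n with
  | zero => simp [RatFunc.intDegree_one]
  | succ n ih =>
    rw [pow_succ, RatFunc.intDegree_mul (pow_ne_zero n hx) hx, ih]
    push_cast
    ring

/-- In `𝔽_p(X)` the variable `X` is not a `p`-th power. [folklore] -/
theorem pow_ne_ratFuncX (p : ℕ) [hp : Fact p.Prime] (s : RatFunc (ZMod p)) :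
    s ^ p ≠ RatFunc.X := by
  intro hs
  by_cases hs0 : s = 0
  · rw [hs0, zero_pow hp.out.ne_zero] at hs
    exact RatFunc.X_ne_zero hs.symm
  · have h := congrArg RatFunc.intDegree hs
    rw [intDegree_pow_of_ne_zero s hs0, RatFunc.intDegree_X] at h
    have h1 : (p : ℤ) = 1 := Int.eq_one_of_mul_eq_one_right (by positivity) h
    exact hp.out.ne_one (by exact_mod_cast h1)

/-- **The concrete instance `K = 𝔽_p(X)`, `t = X`:** `U₂ = K[x^p + X y^p] ⊆ K[x, y]` is graded and
stable under all Hasse–Schmidt derivations, yet admits no presentation `K[ℓ_j^{p^{e_j}}]` by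
independent linear forms. [folklore] -/
theorem ratFunc_counterexample (p : ℕ) [Fact p.Prime] :
    IsGradedSubalgebra
        (Algebra.adjoin (RatFunc (ZMod p)) {frobTwist (RatFunc (ZMod p)) p RatFunc.X}) ∧
      IsDiffStable
        (Algebra.adjoin (RatFunc (ZMod p)) {frobTwist (RatFunc (ZMod p)) p RatFunc.X}) ∧
      ¬ ∃ (r : ℕ) (ℓ : Fin r → MvPolynomial (Fin 2) (RatFunc (ZMod p))) (e : Fin r → ℕ),
        (∀ j, ℓ j ∈ Submodule.span (RatFunc (ZMod p))
          (Set.range (X : Fin 2 → MvPolynomial (Fin 2) (RatFunc (ZMod p))))) ∧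
        LinearIndependent (RatFunc (ZMod p)) ℓ ∧
        Algebra.adjoin (RatFunc (ZMod p)) {frobTwist (RatFunc (ZMod p)) p RatFunc.X} =
          Algebra.adjoin (RatFunc (ZMod p)) (Set.range fun j => ℓ j ^ p ^ e j) := by
  haveI : CharP (RatFunc (ZMod p)) p :=
    charP_of_injective_algebraMap (algebraMap (ZMod p) (RatFunc (ZMod p))).injective p
  exact ⟨isGradedSubalgebra_adjoin_frobTwist _ p _, isDiffStable_adjoin_frobTwist _ p _,
    not_exists_presentation_adjoin_frobTwist _ p _ (pow_ne_ratFuncX p)⟩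

end RatFuncInstance

end Literature.AlgebraicGeometry.Resolution
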